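import Summits.Ventures.YMGap.RobustBall.BoxSumCLT
import Summits.Ventures.YMGap.RobustBall.BoxSumCLTCylinder
import Summits.Ventures.YMGap.RobustBall.UniformMassGapKR
import HarnessLib

/-!
# Venture YMGap, track ROBUST-BALL — «C-CLT» UNIFORMLY ON THE BALL: Gaussian fluctuations for EVERY member of the gauge-invariant
# tier-1 `ℤ^d` ball inside the uniform mass-gap currency, and the `SU(2)` KR-door cells in every dimension

HONEST FRAMING. WHAT THIS IS: a venture file (cell `pub-ymgap`, track Y2 ROBUST-BALL, seat ds-3, theorems only): the BALL form of the
object «C-CLT». rb-p1's uniform currency `UniformMassGapOnBallZdG d N β ε₀ ε₁ R m A` (`UniformMassGap.lean`: every member `(W, supp)` of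
ds-2's gauge-invariant finite-range ball `MemBallZdG ε₀ ε₁ R` has ONE DLR state and clusters on Lipschitz cylinders with the SAME rate
`m > 0` and constant `A n²`) and ds-3's `oneState_translationInvariant_onBallZdG` (that one state is translation invariant as soon as the
member's finite-volume Hamiltonians are translation covariant) feed the adapter `pairClustering_of_perturbedClustering` and the generic
`tendstoInDistribution_boxSum`:
* ★★★ `clt_onBallZdG` — for EVERY member of the ball with translation-covariant Hamiltonians and EVERY Lipschitz cylinder `F`:
  `Σ_v |cov_μ(F, F∘θ_v)| < ∞` and `(Σ_{x∈B_n} F∘θ_x − #B_n μ(F))/√#B_n → N(0, Σ_v cov_μ(F, F∘θ_v))` in distribution;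
* ★★★ `clt_onBallZdS` — the TIER-2 twin: `UniformMassGapOnBallZdS d N β a Λ t m A` (rb-p1's weighted, infinite-range ball `MemBallZdS`)
  and a translation-covariant member (`oneState_translationInvariant_onBallZdS`, no Van Hove join needed) ⇒ the same CLT;
* ★★ `su2_clt_onBallZd` — `SU(2)`, EVERY `d ≥ 1`, the KR door of `UniformMassGapKR.su2_uniformMassGapOnBallZd`: whenever
  `2(d−1)|β_W| e^{ε₀} + e^{ε₀/2} √(2/3) ε₁ ≤ ρ`, `1/2 ≤ ρ < 1` (tree coupling `β_W/2`, 't Hooft `β_W/4`), every member of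
  `MemBallZdG ε₀ ε₁ R` with translation-covariant Hamiltonians satisfies the CLT for every Lipschitz cylinder — e.g. `d = 4`, `ε = 0`:
  the whole single-link window `|β_W| < 1/12·(…)`; the radii trade against the coupling exactly as in the mass-gap rows.
WHAT THIS IS NOT: lattice strong coupling; NOT `χ > 0`, NOT an LDP, nothing spectral / continuum / Clay.
References: the tree's `UniformMassGap.lean`, `UniformMassGapKR.lean`, `OneStateInvariant.lean`, `BoxSumCLT.lean`, `BoxSumCLTCylinder.lean`.
-/

noncomputable section

open MeasureTheory Filter Topology ProbabilityTheory Real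
open scoped NNReal
open Literature.Probability.LatticeModels hiding configShift configShift_apply
open Literature.MathematicalPhysics.QuantumLattice
open Literature.MathematicalPhysics.QuantumFieldTheory hiding ZdEdge Site IsLocalObservable

namespace Summit.Ventures.YMGap.RobustBall

namespace BoxSumCLT

variable {d N : ℕ}

/-- ★★★ **THE CLT UNIFORMLY ON THE GAUGE-INVARIANT TIER-1 BALL.** Let `UniformMassGapOnBallZdG d N β ε₀ ε₁ R m A` (`d ≥ 1`, `A ≥ 0`),
`(W, supp) ∈ MemBallZdG ε₀ ε₁ R` a member with translation-covariant finite-volume Hamiltonians, and `F` a Lipschitz cylinder. Then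
the member has exactly one DLR state `μ` (a probability measure), `μ` is translation invariant, `Σ_v |cov_μ(F, F∘θ_v)| < ∞`, and for
every `Z` with law `N(0, Σ_v cov_μ(F, F∘θ_v))`: `(Σ_{x∈B_n} F∘θ_x − #B_n μ(F))/√#B_n → Z` in distribution. [folklore] -/
theorem clt_onBallZdG (hd : 1 ≤ d) {β ε₀ ε₁ m A : ℝ} {R : ℕ} (hball : UniformMassGapOnBallZdG d N β ε₀ ε₁ R m A) (hA : 0 ≤ A)
    {W : Potential (ZdEdge d) (SUN N)} {supp : Finset (ZdEdge d) → Finset (Finset (ZdEdge d))} (hmem : MemBallZdG ε₀ ε₁ R W supp)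
    (hH : ∀ (Λ : Finset (ZdEdge d)) (v : Site d) (U : LGConfig d (SUN N)),
      hamiltonianIn W supp (Λ.map (edgeShift v).toEmbedding) (configShift v U) = hamiltonianIn W supp Λ U)
    {Ω' : Type*} [MeasurableSpace Ω'] {P' : Measure Ω'} [IsProbabilityMeasure P'] (Z : Ω' → ℝ)
    {F : LGConfig d (SUN N) → ℝ} {Δ : Finset (ZdEdge d)} {K : ℝ≥0} (hF : IsLipschitzCylinder (fundamentalRep (Fin N)) F Δ K) :
    ∃ μ : Measure (LGConfig d (SUN N)), ∃ _ : IsProbabilityMeasure μ,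
      perturbedGibbsMeasures (d := d) (fundamentalRep (Fin N)) ((N : ℝ) * β) W supp = {μ} ∧ IsZdTranslationInvariant μ ∧
      Summable (fun v : Site d => |cov[F, fun U => F (configShift v U); μ]|) ∧
      (HasLaw Z (gaussianReal 0 (∑' v, cov[F, fun U => F (configShift v U); μ]).toNNReal) P' →
        TendstoInDistribution
          (fun n U => (∑ x ∈ siteBox d n, F (configShift x U) - (siteBox d n).card * ∫ V, F V ∂μ) / Real.sqrt ((siteBox d n).card))
          atTop Z (fun _ => μ) P') := by
  classical
  obtain ⟨μ, hG, hinv⟩ := oneState_translationInvariant_onBallZdG hball.massGapOnBallZdG hmem hH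
  have hμ : μ ∈ perturbedGibbsMeasures (d := d) (fundamentalRep (Fin N)) ((N : ℝ) * β) W supp := by
    rw [hG]; exact Set.mem_singleton μ
  have hμG : IsGibbsMeasure (perturbedYM (d := d) (fundamentalRep (Fin N)) ((N : ℝ) * β) W supp) μ := hμ
  haveI := hμG.isProbabilityMeasure
  have hcl : PerturbedClustering d N β W supp m A := (hball.2 W supp hmem).2
  have hFm : Measurable F := hF.measurable
  have hFb : ∀ U, |F U| ≤ |F 1| + 2 * K := hF.abs_le
  set δ : ℝ := ∑ e ∈ Δ, ∑ e' ∈ Δ, ‖e.1 - e'.1‖ with hδdef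
  have hδ : ∀ e ∈ Δ, ∀ e' ∈ Δ, ‖e.1 - e'.1‖ ≤ δ := fun e he e' he' =>
    (Finset.single_le_sum (f := fun e'' : ZdEdge d => ‖e.1 - e''.1‖) (fun _ _ => norm_nonneg _) he').trans
      (Finset.single_le_sum (f := fun e₀ : ZdEdge d => ∑ e'' ∈ Δ, ‖e₀.1 - e''.1‖)
        (fun _ _ => Finset.sum_nonneg fun _ _ => norm_nonneg _) he)
  have hpair := pairClustering_of_perturbedClustering hcl hball.1.le hA hμ hF hδ
  have hA' : (0 : ℝ) ≤ A * (Δ.card : ℝ) ^ 2 * Real.exp (m * δ) * max 1 ((K : ℝ) ^ 2) := by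
    have : (0 : ℝ) ≤ max 1 ((K : ℝ) ^ 2) := le_max_of_le_left zero_le_one
    positivity
  exact ⟨μ, inferInstance, hG, hinv, summable_abs_cov_of_pairClustering hd hFm hFb hball.1 hA' hpair,
    fun hZ => tendstoInDistribution_boxSum hd hinv hFm hFb hball.1 hA' hpair hZ⟩

/-- ★★★ **THE CLT UNIFORMLY ON THE TIER-2 (LINK-SUMMABLE, INFINITE-RANGE) BALL.** Let `UniformMassGapOnBallZdS d N β a Λ t m A`
(`d ≥ 1`, `A ≥ 0`), `W ∈ MemBallZdS a Λ t` a translation-covariant member (`W_{X+v} ∘ θ_v = W_X`), and `F` a Lipschitz cylinder. Then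
the member has exactly one DLR state `μ`, `μ` is translation invariant, `Σ_v |cov_μ(F, F∘θ_v)| < ∞`, and the cube sums of `F` satisfy
the central limit theorem with variance `Σ_v cov_μ(F, F∘θ_v)`. [folklore] -/
theorem clt_onBallZdS (hd : 1 ≤ d) {β a Λ t m A : ℝ} (hball : UniformMassGapOnBallZdS d N β a Λ t m A) (hA : 0 ≤ A)
    {W : Potential (ZdEdge d) (SUN N)} (hmem : MemBallZdS a Λ t W)
    (hW : ∀ (v : Site d) (X : Finset (ZdEdge d)) (U : LGConfig d (SUN N)),
      W (X.map (edgeShift v).toEmbedding) (configShift v U) = W X U)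
    {Ω' : Type*} [MeasurableSpace Ω'] {P' : Measure Ω'} [IsProbabilityMeasure P'] (Z : Ω' → ℝ)
    {F : LGConfig d (SUN N) → ℝ} {Δ : Finset (ZdEdge d)} {K : ℝ≥0} (hF : IsLipschitzCylinder (fundamentalRep (Fin N)) F Δ K) :
    ∃ μ : Measure (LGConfig d (SUN N)), ∃ _ : IsProbabilityMeasure μ,
      perturbedGibbsMeasuresS (d := d) (fundamentalRep (Fin N)) ((N : ℝ) * β) W = {μ} ∧ IsZdTranslationInvariant μ ∧
      Summable (fun v : Site d => |cov[F, fun U => F (configShift v U); μ]|) ∧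
      (HasLaw Z (gaussianReal 0 (∑' v, cov[F, fun U => F (configShift v U); μ]).toNNReal) P' →
        TendstoInDistribution
          (fun n U => (∑ x ∈ siteBox d n, F (configShift x U) - (siteBox d n).card * ∫ V, F V ∂μ) / Real.sqrt ((siteBox d n).card))
          atTop Z (fun _ => μ) P') := by
  classical
  obtain ⟨μ, hG, hinv⟩ := oneState_translationInvariant_onBallZdS hball.massGapOnBallZdS hmem hW
  have hμ : μ ∈ perturbedGibbsMeasuresS (d := d) (fundamentalRep (Fin N)) ((N : ℝ) * β) W := by
    rw [hG]; exact Set.mem_singleton μ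
  have hμG : IsGibbsMeasure (perturbedYMS (d := d) (fundamentalRep (Fin N)) ((N : ℝ) * β) W) μ := hμ
  haveI := hμG.isProbabilityMeasure
  have hcl : PerturbedClusteringS d N β W m A := (hball.2 W hmem).2
  have hFm : Measurable F := hF.measurable
  have hFb : ∀ U, |F U| ≤ |F 1| + 2 * K := hF.abs_le
  set δ : ℝ := ∑ e ∈ Δ, ∑ e' ∈ Δ, ‖e.1 - e'.1‖ with hδdef
  have hδ : ∀ e ∈ Δ, ∀ e' ∈ Δ, ‖e.1 - e'.1‖ ≤ δ := fun e he e' he' =>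
    (Finset.single_le_sum (f := fun e'' : ZdEdge d => ‖e.1 - e''.1‖) (fun _ _ => norm_nonneg _) he').trans
      (Finset.single_le_sum (f := fun e₀ : ZdEdge d => ∑ e'' ∈ Δ, ‖e₀.1 - e''.1‖)
        (fun _ _ => Finset.sum_nonneg fun _ _ => norm_nonneg _) he)
  have hpair := pairClustering_of_perturbedClusteringS hcl hball.1.le hA hμ hF hδ
  have hA' : (0 : ℝ) ≤ A * (Δ.card : ℝ) ^ 2 * Real.exp (m * δ) * max 1 ((K : ℝ) ^ 2) := by
    have : (0 : ℝ) ≤ max 1 ((K : ℝ) ^ 2) := le_max_of_le_left zero_le_one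
    positivity
  exact ⟨μ, inferInstance, hG, hinv, summable_abs_cov_of_pairClustering hd hFm hFb hball.1 hA' hpair,
    fun hZ => tendstoInDistribution_boxSum hd hinv hFm hFb hball.1 hA' hpair hZ⟩

/-- ★★ **`SU(2)` CELLS ON THE WHOLE TIER-1 BALL, EVERY `d ≥ 1` (KR door).** If `2(d−1)|β_W| e^{ε₀} + e^{ε₀/2}√(2/3) ε₁ ≤ ρ` with
`1/2 ≤ ρ < 1`, then EVERY member `(W, supp)` of the gauge-invariant ball `MemBallZdG ε₀ ε₁ R` ('t Hooft coupling `β_W/4`) with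
translation-covariant Hamiltonians has one translation-invariant DLR state whose cube sums of EVERY Lipschitz cylinder satisfy the
central limit theorem (clustering data: rate `(1 − ρ)/max(1, R)`, constant `32 n²`, `UniformMassGapKR.su2_uniformMassGapOnBallZd`).
[folklore] -/
theorem su2_clt_onBallZd (hd : 1 ≤ d) {βW ε₀ ε₁ ρ : ℝ} (R : ℕ)
    (hρ : 2 * ((d : ℝ) - 1) * |βW| * Real.exp ε₀ + Real.exp (ε₀ / 2) * Real.sqrt (2 / 3) * ε₁ ≤ ρ) (hhalf : 1 / 2 ≤ ρ) (hρ1 : ρ < 1)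
    {W : Potential (ZdEdge d) (SUN 2)} {supp : Finset (ZdEdge d) → Finset (Finset (ZdEdge d))} (hmem : MemBallZdG ε₀ ε₁ R W supp)
    (hH : ∀ (Λ : Finset (ZdEdge d)) (v : Site d) (U : LGConfig d (SUN 2)),
      hamiltonianIn W supp (Λ.map (edgeShift v).toEmbedding) (configShift v U) = hamiltonianIn W supp Λ U)
    {Ω' : Type*} [MeasurableSpace Ω'] {P' : Measure Ω'} [IsProbabilityMeasure P'] (Z : Ω' → ℝ)
    {F : LGConfig d (SUN 2) → ℝ} {Δ : Finset (ZdEdge d)} {K : ℝ≥0} (hF : IsLipschitzCylinder (fundamentalRep (Fin 2)) F Δ K) :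
    ∃ μ : Measure (LGConfig d (SUN 2)), ∃ _ : IsProbabilityMeasure μ,
      perturbedGibbsMeasures (d := d) (fundamentalRep (Fin 2)) ((2 : ℕ) * (βW / 4)) W supp = {μ} ∧ IsZdTranslationInvariant μ ∧
      Summable (fun v : Site d => |cov[F, fun U => F (configShift v U); μ]|) ∧
      (HasLaw Z (gaussianReal 0 (∑' v, cov[F, fun U => F (configShift v U); μ]).toNNReal) P' →
        TendstoInDistribution
          (fun n U => (∑ x ∈ siteBox d n, F (configShift x U) - (siteBox d n).card * ∫ V, F V ∂μ) / Real.sqrt ((siteBox d n).card))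
          atTop Z (fun _ => μ) P') :=
  clt_onBallZdG hd ((su2_uniformMassGapOnBallZd hd (R : ℝ) hρ hhalf hρ1).uniformMassGapOnBallZdG) (by norm_num) hmem hH Z hF

end BoxSumCLT

end Summit.Ventures.YMGap.RobustBall

end
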